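import Literature.Computability.AlgebraicComplexity.KV20NonRigidEquations
import Literature.Computability.AlgebraicComplexity.RankMethodBarriers
import Literature.Computability.AlgebraicComplexity.BasicTensorSubspaces
import HarnessLib

/-!
# Kumar–Volk: equations for small linear circuits and low-rank tensors (typed statements of
# §1.3, §4 and §5: Lemma 4.1, Thm 1.2, Lemma 5.4, Thm 5.5, Lemma 5.6, Thm 1.4)

Second section file of M. Kumar, B. L. Volk, *A polynomial degree bound on equations for non-rigid
matrices and small linear circuits*, ACM TOCT 14(2) (2022) art. 6 = arXiv:2003.12938 (bib key
`KumarVolk2022`; JOURNAL numbering; locators `[s2 pNNNN]` = chunks of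
`lit read paper:doi-10-1145-3543685`, `[tex pNNNN]` = `lit read paper:arxiv-2003.12938`). The
first section file `KV20NonRigidEquations.lean` has §1.1–§1.2, §2–§3 (`IsEquationFor`,
`minEquationDegree`, `matrixOfPt`, `polyMapImage`, rigidity, Thm 1.1, Lemmas 2.1, 3.1, 3.2) and the
conventions; this file adds the linear-circuit model of §1.3, Lemma 4.1 and Thm 1.2 (§4), and the
tensor statements of §5 over the tree's `rankOneTensor` / `tensorRankD` (Def 5.1–5.3 CITED from
`RankMethodBarriers.lean`, not restated). Honest framing (val-lit): cite-tagged `def … : Prop`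
named facts (D-0014) + small proved API lemmas; unconditional theorems of the source,
dischargeable by name; nothing here bears on `VP ≠ VNP`.

Linear circuits (§1.3, [s2 p0005]: "A linear circuit is a directed acyclic graph that has `n`
inputs labeled `X_1, …, X_n` and `n` output nodes. Each edge is labeled by a scalar `α ∈ F`. Each
node computes a linear function in `X_1, …, X_n` defined inductively … The size of the circuit is
the number of edges") are taken in the layered normal form of the source's §4.1 (input nodes,
internal gates, `n` output SINK nodes): gates `0, …, m-1` topologically numbered; `inW g i` = label
of the edge `X_i → g`, `gateW g g'` = label of the edge `g' → g` (only `g' < g`, `acyclic`),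
`outW j u` = label of the edge from input/gate `u` into output node `j`; label `0` = no edge (a
`0`-labelled edge contributes nothing and parallel edges merge, so no generality is lost); output
node `j` computes row `j` of `A`, `x ↦ (A x)_j`; size = number of nonzero labels. Every DAG admits
a topological numbering; output nodes that feed further nodes or coincide, if one reads §1.3 as
allowing them, cost at most one extra edge per output in this normal form — the form in which the
source's universal graph (Lemma 4.1) embeds circuits; all typed statements are the printed ones for
this model (v3 of this file: v1/v2 designated gates as outputs; re-modelled to match §4.1 exactly).
The source's `ℕ = {1,2,…}`: Thm 5.5 / 1.4 carry `1 ≤ n` (`1 ≤ d`) —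
for `n = 0` the sentence is false in Lean (only the empty tensor; a nonzero equation of degree
`≤ 0` is a nonzero constant); rank bounds are floor divisions ("at most").
-/

noncomputable section

open MvPolynomial

namespace Literature.Computability.AlgebraicComplexity

/-! ### §1.3 Linear circuits -/

/-- **Linear circuits** (KV §1.3, [s2 p0005]: "A linear circuit is a directed acyclic graph that has
`n` inputs labeled `X_1, …, X_n` and `n` output nodes. Each edge is labeled by a scalar `α ∈ F`.
Each node computes a linear function in `X_1, …, X_n` defined inductively. An internal node `u` with
children `v_1, …, v_k`, connected to it by edges labeled `α_1, …, α_k`, computes the linear function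
`∑_i α_i ℓ_{v_i}` … The size of the circuit is the number of edges in the circuit."), in the
layered normal form of the module docstring (= the shape of the source's universal graph, §4.1):
`m` internal gates `0, …, m-1`, `inW g i` the label of the edge `X_i → g`, `gateW g g'` the label of
the edge `g' → g` (only `g' < g`), `outW j u` the label of the edge from input/gate `u` into the
output (sink) node `j`; label `0` = no edge. [cite: KumarVolk2022, §1.3] -/
structure LinCircuit (F : Type*) [Zero F] (n m : ℕ) where
  /-- label of the edge from input `X_i` into gate `g` (`0` = no edge) -/
  inW : Fin m → Fin n → F
  /-- label of the edge from gate `g'` into gate `g` (`0` = no edge) -/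
  gateW : Fin m → Fin m → F
  /-- acyclicity: edges only from earlier gates -/
  acyclic : ∀ g g', gateW g g' ≠ 0 → g' < g
  /-- label of the edge from input `X_i` (`inl i`) or gate `g` (`inr g`) into output node `j` -/
  outW : Fin n → Fin n ⊕ Fin m → F

namespace LinCircuit

variable {F : Type*} [Field F] {n m : ℕ}

/-- The circuit computes the matrix `A`: there is a gate valuation `v` (gate `g` computes the linear
form with coefficient vector `v g`, i.e. `x ↦ ∑_i v g i · x_i`) satisfying the defining equations
`v g = inW g + ∑_{g'} gateW g g' · v g'` (inputs compute `X_i`), and output node `j` computes row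
`j` of `A`, `x ↦ (A x)_j`: `A j = ∑_i outW j (inl i) · e_i + ∑_g outW j (inr g) · v g` (KV §1.3
"defined inductively"; by acyclicity the valuation is unique). [cite: KumarVolk2022, §1.3] -/
def Computes (C : LinCircuit F n m) (A : Matrix (Fin n) (Fin n) F) : Prop :=
  ∃ v : Fin m → Fin n → F,
    (∀ g, v g = C.inW g + ∑ g', C.gateW g g' • v g') ∧
      ∀ j, A j = (fun i => C.outW j (Sum.inl i)) + ∑ g, C.outW j (Sum.inr g) • v g

/-- The size of a linear circuit: its number of edges (KV §1.3), i.e. of nonzero labels.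
[cite: KumarVolk2022, §1.3] -/
def size (C : LinCircuit F n m) : ℕ :=
  Nat.card {p : Fin m × Fin n // C.inW p.1 p.2 ≠ 0} +
    Nat.card {p : Fin m × Fin m // C.gateW p.1 p.2 ≠ 0} +
      Nat.card {p : Fin n × (Fin n ⊕ Fin m) // C.outW p.1 p.2 ≠ 0}

end LinCircuit

section LinearCircuits

variable (F : Type*) [Field F] {n : ℕ}

/-- "`A`'s linear transformation can be computed by a linear circuit of size at most `s`"
(KV §1.3 / Thm 1.2). [cite: KumarVolk2022, §1.3] -/
def HasLinCircuit (s : ℕ) (A : Matrix (Fin n) (Fin n) F) : Prop :=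
  ∃ (m : ℕ) (C : LinCircuit F n m), C.size ≤ s ∧ C.Computes A

variable {F}

/-- Monotonicity in the size budget. [cite: KumarVolk2022, §1.3] -/
theorem hasLinCircuit_mono {s s' : ℕ} {A : Matrix (Fin n) (Fin n) F} (h : HasLinCircuit F s A)
    (hs : s ≤ s') : HasLinCircuit F s' A := by
  obtain ⟨m, C, hC, hA⟩ := h
  exact ⟨m, C, hC.trans hs, hA⟩

/-- The gate-free circuit of a matrix: output node `j` has an edge from `X_i` labelled `A j i` for
every `i` (KV §1.3: "any such linear transformation can be computed by a circuit of size `n²`").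
[cite: KumarVolk2022, §1.3] -/
def trivialLinCircuit (A : Matrix (Fin n) (Fin n) F) : LinCircuit F n 0 where
  inW := fun g => g.elim0
  gateW := fun g => g.elim0
  acyclic := fun g => g.elim0
  outW := fun j u => Sum.elim (fun i => A j i) (fun g => g.elim0) u

/-- The gate-free circuit computes `A`. [cite: KumarVolk2022, §1.3] -/
theorem trivialLinCircuit_computes (A : Matrix (Fin n) (Fin n) F) :
    (trivialLinCircuit A).Computes A :=
  ⟨fun g => g.elim0, fun g => g.elim0, fun j => by ext i; simp [trivialLinCircuit]⟩

/-- The gate-free circuit has at most `n²` edges. [cite: KumarVolk2022, §1.3] -/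
theorem trivialLinCircuit_size_le (A : Matrix (Fin n) (Fin n) F) :
    (trivialLinCircuit A).size ≤ n ^ 2 := by
  have h1 : Nat.card {p : Fin 0 × Fin n // (trivialLinCircuit A).inW p.1 p.2 ≠ 0} = 0 :=
    Nat.card_eq_zero.2 (Or.inl ⟨fun p => p.1.1.elim0⟩)
  have h2 : Nat.card {p : Fin 0 × Fin 0 // (trivialLinCircuit A).gateW p.1 p.2 ≠ 0} = 0 :=
    Nat.card_eq_zero.2 (Or.inl ⟨fun p => p.1.1.elim0⟩)
  have h3 : Nat.card {p : Fin n × (Fin n ⊕ Fin 0) // (trivialLinCircuit A).outW p.1 p.2 ≠ 0} ≤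
      n ^ 2 :=
    calc Nat.card {p : Fin n × (Fin n ⊕ Fin 0) // (trivialLinCircuit A).outW p.1 p.2 ≠ 0}
        ≤ Nat.card (Fin n × (Fin n ⊕ Fin 0)) := Finite.card_subtype_le _
      _ = n ^ 2 := by simp [pow_two]
  unfold LinCircuit.size
  omega

/-- Every `n × n` matrix has a linear circuit with at most `n²` edges (KV §1.3, "Note that this is
nearly optimal as any such linear transformation can be computed by a circuit of size `n²`").
[cite: KumarVolk2022, §1.3] -/
theorem hasLinCircuit_sq (A : Matrix (Fin n) (Fin n) F) : HasLinCircuit F (n ^ 2) A :=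
  ⟨0, trivialLinCircuit A, trivialLinCircuit_size_le A, trivialLinCircuit_computes A⟩

variable (F)

/-- The set of (points of) matrices computed by linear circuits of size at most `s`
(KV §1.3 / Thm 1.2: "a variety containing all matrices `A ∈ F^{n×n}` whose corresponding linear
transformation can be computed by an algebraic circuit of size at most `n²/200`").
[cite: KumarVolk2022, §1.3] -/
def smallLinCircuitSet (n s : ℕ) : Set (Fin n × Fin n → F) :=
  {x | HasLinCircuit F s (matrixOfPt F x)}

end LinearCircuits

/-! ### §4: the universal map (Lemma 4.1) and Theorem 1.2 -/

/-- **Kumar–Volk, Lemma 4.1** ([s2 p0014]; arXiv Lemma 8): for `s ≥ n`, "The map `U(x, y) : F^{2s}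
→ F^{n²}` defined above contains in its image all `n × n` matrices `A` whose corresponding linear
transformation can be computed by a linear circuit of size at most `s`. The degree of `U` is at
most `s'·(s+1)`", where `s' ≤ s⁴` is the number of edges of the universal graph `G` for size `s`
(§4.1) whose edges are labelled by the coordinates of `SV_{s',s}(x,y)` (Lemma 3.1, which needs
`|F| > s'`). Typed in existential form with the explicit bounds `s' ≤ s⁴`: field size `> s⁴`
(an embedding `Fin (s⁴+1) ↪ F`, sufficient for the printed construction), degree `≤ s⁴(s+1)`, and
with `4 ≤ s`: the universal graph has `s' = 2ns² + n² + s³(s-1)/2` edges, which is `≤ s⁴` exactly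
when `s ≥ 4` (e.g. `s = n = 3` gives `s' = 90 > 81`), so the printed "`s' ≤ s⁴`" and hence this
typed form are what the construction proves for `s ≥ 4` (Thm 1.2 uses `s = n²/200 → ∞`).
[cite: KumarVolk2022, Lemma 4.1] -/
def kumarVolk2020_lem_4_1 : Prop :=
  ∀ (F : Type) [Field F] (n s : ℕ), n ≤ s → 4 ≤ s → Nonempty (Fin (s ^ 4 + 1) ↪ F) →
    ∃ U : Fin n × Fin n → MvPolynomial (Fin s ⊕ Fin s) F,
      (∀ p, (U p).totalDegree ≤ s ^ 4 * (s + 1)) ∧ smallLinCircuitSet F n s ⊆ polyMapImage U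

/-- **Kumar–Volk, Thm 1.2** ([s2 p0005:L7]; arXiv Thm 2, [tex p0003]): "Let `F` be a field of size at
least `n²`. For every large enough `n`, there exists a non-zero polynomial `Q ∈ F[x_{1,1}, …,
x_{n,n}]`, of degree at most `n³`, which is a non-trivial equation for matrices that are computed
by algebraic circuit of size at most `n²/200`." (Linear circuits, §1.3; size = number of edges.)
[cite: KumarVolk2022, Thm. 1.2] -/
def kumarVolk2020_thm_1_2 : Prop :=
  ∃ n₀ : ℕ, ∀ n : ℕ, n₀ ≤ n → ∀ (F : Type) [Field F], Nonempty (Fin (n ^ 2) ↪ F) →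
    ∃ Q : MvPolynomial (Fin n × Fin n) F,
      IsEquationFor (smallLinCircuitSet F n (n ^ 2 / 200)) Q ∧ Q.totalDegree ≤ n ^ 3

/-! ### §5: low-rank tensors (Lemma 5.4, Thm 5.5, Lemma 5.6, Thm 1.4)

Tensors `τ : [n]^d → F` (Def 5.1), rank-one tensors (Def 5.2) and tensor rank (Def 5.3) are the
tree's `(Fin d → Fin n) → F`, `rankOneTensor`, `tensorRankD` (EGOW vocabulary of
`RankMethodBarriers.lean`), cited rather than restated. A tensor IS a point of the affine space with
coordinates indexed by `Fin d → Fin n`, so `IsEquationFor` applies directly. -/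

section Tensors

variable (F : Type*) [Field F]

/-- The set of `d`-dimensional tensors of side `n` and rank at most `r` (KV §5, Def 5.3 = the
tree's `tensorRankD`). [cite: KumarVolk2022, Def. 5.3] -/
def lowRankTensorSet (n d r : ℕ) : Set ((Fin d → Fin n) → F) :=
  {τ | tensorRankD τ ≤ r}

variable {F}

/-- Membership unfolding. [cite: KumarVolk2022, Def. 5.3] -/
theorem mem_lowRankTensorSet_iff {n d r : ℕ} (τ : (Fin d → Fin n) → F) :
    τ ∈ lowRankTensorSet F n d r ↔ tensorRankD τ ≤ r :=
  Iff.rfl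

/-- Rank-one tensors lie in every `lowRankTensorSet … r` with `1 ≤ r`. [cite: KumarVolk2022, Def. 5.2] -/
theorem rankOneTensor_mem_lowRankTensorSet {n d r : ℕ} (hr : 1 ≤ r) (u : Fin d → Fin n → F) :
    rankOneTensor u ∈ lowRankTensorSet F n d r :=
  (tensorRankD_rankOneTensor_le u).trans hr

end Tensors

/-- **Kumar–Volk, Lemma 5.4** ([s2 p0016]; arXiv Lemma 9 for `r = n²/300`): "Let `F` be any field.
There is a polynomial map `P : F^{3nr} → F^{n³}` of degree `3` such that every `3`-dimensional
tensor `τ : [n]³ → F` of rank at most `r` lies in its image." (`P` = coordinates of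
`∑_{i ≤ r} u_i ⊗ v_i ⊗ w_i` in the `3nr` variables `u, v, w`.) Variables indexed by
`Fin 3 × Fin r × Fin n`; degree "at most `3`". PROVED below (`kumarVolk2020_lem_5_4_holds`, the case
`d = 3` of Lemma 5.6). [cite: KumarVolk2022, Lemma 5.4] -/
def kumarVolk2020_lem_5_4 : Prop :=
  ∀ (F : Type) [Field F] (n r : ℕ),
    ∃ P : (Fin 3 → Fin n) → MvPolynomial (Fin 3 × Fin r × Fin n) F,
      (∀ i, (P i).totalDegree ≤ 3) ∧ lowRankTensorSet F n 3 r ⊆ polyMapImage P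

/-- **Kumar–Volk, Thm 5.5** ([s2 p0016]; arXiv Thm 10, [tex p0007]): "Let `F` be any field. There
exists a non-zero polynomial `Q ∈ F[x_{1,1,1}, …, x_{n,n,n}]`, of degree at most `n⁴`, which is a
non-trivial equation for three dimensional tensors `τ : [n]×[n]×[n] → F` of rank at most `n²/300`."
Typed for `1 ≤ n` (module docstring: `n ∈ ℕ = {1,2,…}`). [cite: KumarVolk2022, Thm. 5.5] -/
def kumarVolk2020_thm_5_5 : Prop :=
  ∀ (F : Type) [Field F] (n : ℕ), 1 ≤ n →
    ∃ Q : MvPolynomial (Fin 3 → Fin n) F,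
      IsEquationFor (lowRankTensorSet F n 3 (n ^ 2 / 300)) Q ∧ Q.totalDegree ≤ n ^ 4

/-- **Kumar–Volk, Lemma 5.6** ([s2 p0016]; arXiv Lemma 11): "Let `F` be any field. Then, for all
`n, d ∈ ℕ`, there is a polynomial map `P : F^{dnr} → F^{n^d}` of degree at most `d` such that every
`d`-dimensional tensor `τ : [n]^{⊗d} → F` of rank at most `r` lies in its image." Variables indexed
by `Fin d × Fin r × Fin n`; `1 ≤ d` (the source's `ℕ = {1,2,…}`; for `d = 0` the sentence fails in
Lean: the `0`-dimensional tensors of rank `≤ r` form all of `F` under the tree's `tensorRankD` junk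
conventions while a degree-`0` map has a one-point image — ERRATUM to the first landing of this file,
which omitted the hypothesis). PROVED below (`kumarVolk2020_lem_5_6_holds`).
[cite: KumarVolk2022, Lemma 5.6] -/
def kumarVolk2020_lem_5_6 : Prop :=
  ∀ (F : Type) [Field F] (n d r : ℕ), 1 ≤ d →
    ∃ P : (Fin d → Fin n) → MvPolynomial (Fin d × Fin r × Fin n) F,
      (∀ i, (P i).totalDegree ≤ d) ∧ lowRankTensorSet F n d r ⊆ polyMapImage P

/-- **Kumar–Volk, Thm 1.4** ([s2 p0005:L17–18]; arXiv Thm 12, [tex p0007]): "For every field `F` and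
for all `n, d ∈ ℕ`, there exists a non-zero polynomial `Q` on `n^d` variables and degree at most
`n^{2d}`, which is a non-trivial equation for `d`-dimensional tensors `τ : [n]^{⊗d} → F` of rank at
most `n^{d-1}/(100d)`." ("We skip the details of the proof": Lemma 5.6 with `r = n^{d-1}/(100d)` and
the dimension count of Lemma 2.1.) Typed for `1 ≤ n`, `1 ≤ d` (module docstring).
[cite: KumarVolk2022, Thm. 1.4] -/
def kumarVolk2020_thm_1_4 : Prop :=
  ∀ (F : Type) [Field F] (n d : ℕ), 1 ≤ n → 1 ≤ d →
    ∃ Q : MvPolynomial (Fin d → Fin n) F,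
      IsEquationFor (lowRankTensorSet F n d (n ^ (d - 1) / (100 * d))) Q ∧
        Q.totalDegree ≤ n ^ (2 * d)

/-! ### Discharges: Lemma 5.6 and Lemma 5.4 (the explicit parametrisation of rank-`≤ r` tensors) -/

/-- **Proof of Lemma 5.6**: `P_idx = ∑_{t < r} ∏_{j < d} X_{(j,t,idx j)}` — the coordinates of
`∑_t u_{1,t} ⊗ ⋯ ⊗ u_{d,t}` — has degree `≤ d`, and a tensor of rank `≤ r` is such a sum with
exactly `r` terms (pad with zeros; the tree's `exists_sum_rankOneTensor_eq_of_tensorRankD_le`).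
[cite: KumarVolk2022, Lemma 5.6] -/
theorem kumarVolk2020_lem_5_6_holds : kumarVolk2020_lem_5_6 := by
  intro F _ n d r hd
  haveI : NeZero d := ⟨by omega⟩
  refine ⟨fun idx => ∑ t : Fin r, ∏ j : Fin d, X (j, t, idx j), fun idx => ?_, fun τ hτ => ?_⟩
  · refine (totalDegree_finsetSum _ _).trans (Finset.sup_le fun t _ => ?_)
    refine (totalDegree_finsetProd _ _).trans ?_
    calc ∑ j : Fin d, (X (j, t, idx j) : MvPolynomial (Fin d × Fin r × Fin n) F).totalDegree
        ≤ ∑ _j : Fin d, 1 := Finset.sum_le_sum fun j _ => (totalDegree_X (R := F) _).le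
      _ = d := by simp
  · obtain ⟨u, hu⟩ := exists_sum_rankOneTensor_eq_of_tensorRankD_le (F := F)
      ((mem_lowRankTensorSet_iff τ).mp hτ)
    refine ⟨fun v => u v.2.1 v.1 v.2.2, ?_⟩
    funext idx
    rw [← hu]
    simp only [map_sum, map_prod, eval_X, Finset.sum_apply, rankOneTensor_apply]

/-- **Proof of Lemma 5.4** (= Lemma 5.6 for `d = 3`). [cite: KumarVolk2022, Lemma 5.4] -/
theorem kumarVolk2020_lem_5_4_holds : kumarVolk2020_lem_5_4 :=
  fun F _ n r => kumarVolk2020_lem_5_6_holds F n 3 r (by norm_num)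

end Literature.Computability.AlgebraicComplexity
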